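import Summits.QuantumFields.YangMills.Theorems.PoincareLipschitzCovariantSourcedMeanValue
import Summits.QuantumFields.YangMills.Theorems.PoincareLipschitzCovariantOneFormSource
import Summits.QuantumFields.YangMills.Theorems.PoincareLipschitzCovariantAntideriv
import HarnessLib

/-!
# Line «poincare_lipschitz» on crux `HistoryTailL` (stmt-QuantumFields-19936), route crux `BlockLipschitzL` (stmt-QuantumFields-23533), K2 supplier plan —
# THE (R3)-COV ROW FOR 1-FORMS IN (V, τ) LETTERS: covariant curl `≤ κ`, covariant divergence `≤ δ`, plaquette holonomy defect `≤ θ`, `sup‖Y‖ ≤ S` on a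
# neighbourhood ⟹ `‖Y(x₀,μ)‖² ≤ 4K·Σ_{Q_R(x₀)}‖Y(·,μ)‖² + (4K(2R+1)^d + 2)·(64·2^d·d·(κ + δ + (2R+3)(d−1)θS)·(2R+1))²`, `K = 16(336d2^d)^d/R^d` —
# genuinely covariant, flat constants, the curvature term in the DISPLAYED `(2R+3)θS` slot (the located `R²θ·sup` wall)

Cell `ym3-torus` (YM ladder rung R3 = continuum SU(2) Yang–Mills on the three-torus — a RUNG, NOT the Clay problem: not d = 4, not infinite volume, not a
mass gap); width seat `ym3-torus-px7` gen 4 («COV-ONE-FORM-MV», ★w5-19936 g11's first refusal to px7, bus 2026-08-29T01:35Z/01:45Z; LEAD ym-ust-19936-w1 g7's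
covariant road, card v1.28 (c)/v1.30).  THEOREMS ONLY (def-free); the shared (V, τ) letters; `--supports stmt-QuantumFields-23533`.  Nothing here proves
`hStab`, F6, a stub, `BlockLipschitzL`, `HistoryTailL` or a summit statement; the torus∕`Ad`∕op-norm BRIDGE to the fields of record is ★w5 g11's «COV-BRIDGE».

ASSEMBLY (= ✓`Prop7FlatSourcedMeanValue.sq_le_of_curl_div_bounds` with a connection).  For a bond field `Y : ℤ^d → Fin d → V` and a direction `μ`,
★w5's ✓`PoincareLipschitzCovariantOneFormSource.covLop_oneForm_eq` writes `(Σ_ν D*_νD_ν)(Y·μ) = Σ_ν D*_ν G_μ(·,ν) + E_μ` EXACTLY, with the divergence-form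
data `G_μ(y,ν) = C(y;ν,μ) − [ν = μ]·τ μ y (Dv(y+e_μ))` (`C` the covariant curl, `Dv` the covariant divergence; `‖G_μ‖ ≤ κ + δ`, ✓`norm_oneFormData_le`) and
the CURVATURE TERM `E_μ` (`‖E_μ‖ ≤ θ(d−1)S`, ✓`norm_curvTerm_le_of_sup`); ★w5's ✓`PoincareLipschitzCovariantAntideriv.exists_cov_antideriv` turns `E_μ` into
divergence-form data `g₀` with `‖g₀‖ ≤ (2R+3)·θ(d−1)S` on `Q_{R+1}(x₀)`; then px7's ✓`PoincareLipschitzCovariantSourcedMeanValue.normSq_le_of_covSourced`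
(harmonic replacement + Kato mean value + vector-Stampacchia Dirichlet sup) at `κ_mass = 0`, `m := κ + δ + (2R+3)(d−1)θS`.

* ★★ `normSq_le_of_cov_curl_div_hol` — the title.  HYPOTHESES live on `Q_{R+1}(x₀)` (curl, divergence at `y+e_μ`, holonomy defect) and on its unit
  neighbourhood (the sup `S` of `‖Y‖` at the shifted sites `y − e_ν + e_μ`).  NO smallness of the connection beyond the plaquette defect `θ` it DISPLAYS.
HONEST: the `θS(2R+3)(2R+1)` product is the located absorption term — small iff `R²θ ≲ 1` at the scale used (LOCATE (R3)-LIN v2 §9: fine up to depth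
`j+1 ≲ 3K/4` with the scale choice of ✓`PoincareLipschitzScaleOptimisation`; the top quarter needs the curvature non-perturbatively). [folklore]
-/

set_option autoImplicit false

noncomputable section

open scoped BigOperators
open Finset

namespace Summit.QuantumFields.YangMills.Theorems.PoincareLipschitzCovariantOneFormMeanValue

open Literature.MathematicalPhysics.QuantumFieldTheory.Balaban1983to89
open B4Eq19LatticeOperators
open Summit.QuantumFields.YangMills.Theorems.PoincareLipschitzCovariantSourcedMeanValue (normSq_le_of_covSourced)
open Summit.QuantumFields.YangMills.Theorems.PoincareLipschitzCovariantOneFormSource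
  (covDvg_add covLop_oneForm_eq norm_oneFormData_le norm_curvTerm_le_of_sup)
open Summit.QuantumFields.YangMills.Theorems.PoincareLipschitzCovariantAntideriv (exists_cov_antideriv)

variable {d : ℕ} {V : Type*} [NormedAddCommGroup V] [InnerProductSpace ℝ V]

/-- ★★ **THE COVARIANT INTERIOR ESTIMATE FOR 1-FORMS ((R3)-COV row shape, (V, τ) letters).**  `V` finite-dimensional, any connection by linear isometries
`τ`; `d ≥ 1`, `R ≥ 4`, `κ, δ, θ, S ≥ 0`; for a bond field `Y` and a direction `μ` assume on `y ∈ Q_{R+1}(x₀)`: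
(curl) `‖(τ ν y (Y (y+e_ν) μ) − Y y μ) − (τ μ y (Y (y+e_μ) ν) − Y y ν)‖ ≤ κ` for all `ν`;
(divergence, read at `y + e_μ`) `‖Σ_ν ((τ ν (y+e_μ−e_ν))⁻¹ (Y (y+e_μ−e_ν) ν) − Y (y+e_μ) ν)‖ ≤ δ`;
(holonomy) `‖τ μ (y−e_ν) (τ ν (y−e_ν+e_μ) ((τ μ y)⁻¹ ((τ ν (y−e_ν))⁻¹ v))) − v‖ ≤ θ‖v‖` for `ν ≠ μ` and all `v`;
(sup) `‖Y (y−e_ν+e_μ) ν‖ ≤ S` for `ν ≠ μ`.  THEN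
`‖Y x₀ μ‖² ≤ 4K·Σ_{y ∈ Q_R(x₀)} ‖Y y μ‖² + (4K(2R+1)^d + 2)·(64·2^d·d·(κ + δ + (2(R+1)+1)·(θ·((d−1)·S)))·(2R+1))²`, `K = 16(336·d·2^d)^d/R^d`.
[folklore] [cite: Giaquinta1984, Ch. III §2 (2.5) p.78; Balaban1984PropagatorsII, (1.9) p.226; Balaban1985BackgroundPropagators, (3.23)-(3.25) p.394] -/
theorem normSq_le_of_cov_curl_div_hol [FiniteDimensional ℝ V] (hd : 1 ≤ d) (τ : Fin d → Zd d → (V ≃ₗᵢ[ℝ] V)) (Y : Zd d → Fin d → V)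
    (x₀ : Zd d) {R : ℤ} (hR : 4 ≤ R) (μ : Fin d) {κ δ θ S : ℝ} (hκ0 : 0 ≤ κ) (hδ0 : 0 ≤ δ) (hθ0 : 0 ≤ θ) (hS0 : 0 ≤ S)
    (hcurl : ∀ y ∈ box x₀ (R + 1), ∀ ν,
      ‖(τ ν y (Y (y + unitVec ν) μ) - Y y μ) - (τ μ y (Y (y + unitVec μ) ν) - Y y ν)‖ ≤ κ)
    (hdiv : ∀ y ∈ box x₀ (R + 1),
      ‖∑ ν, ((τ ν (y + unitVec μ - unitVec ν)).symm (Y (y + unitVec μ - unitVec ν) ν) - Y (y + unitVec μ) ν)‖ ≤ δ)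
    (hHol : ∀ y ∈ box x₀ (R + 1), ∀ ν : Fin d, ν ≠ μ → ∀ v : V,
      ‖τ μ (y - unitVec ν) (τ ν (y - unitVec ν + unitVec μ) ((τ μ y).symm ((τ ν (y - unitVec ν)).symm v))) - v‖ ≤ θ * ‖v‖)
    (hS : ∀ y ∈ box x₀ (R + 1), ∀ ν : Fin d, ν ≠ μ → ‖Y (y - unitVec ν + unitVec μ) ν‖ ≤ S) :
    ‖Y x₀ μ‖ ^ 2 ≤ 4 * (16 * (336 * (d : ℝ) * (2 : ℝ) ^ d) ^ d / (R : ℝ) ^ d) * ∑ y ∈ box x₀ R, ‖Y y μ‖ ^ 2 +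
      (4 * (16 * (336 * (d : ℝ) * (2 : ℝ) ^ d) ^ d / (R : ℝ) ^ d) * (2 * (R : ℝ) + 1) ^ d + 2) *
        (64 * (2 : ℝ) ^ d * d * (κ + δ + (2 * ((R : ℝ) + 1) + 1) * (θ * (((d : ℝ) - 1) * S))) * (2 * (R : ℝ) + 1)) ^ 2 := by
  classical
  have hd0 : 0 < d := hd
  -- the letters of the source identity
  set C : Zd d → Fin d → Fin d → V := fun x ν μ' => (τ ν x (Y (x + unitVec ν) μ') - Y x μ') - (τ μ' x (Y (x + unitVec μ') ν) - Y x ν) with hC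
  set Dv : Zd d → V := fun x => ∑ ν, ((τ ν (x - unitVec ν)).symm (Y (x - unitVec ν) ν) - Y x ν) with hDv
  set G : Zd d → Fin d → V := fun y ν => C y ν μ - (if ν = μ then τ μ y (Dv (y + unitVec μ)) else 0) with hG
  set E : Zd d → V := fun y => ∑ ν, ((τ ν (y - unitVec ν)).symm (τ μ (y - unitVec ν) (Y (y - unitVec ν + unitVec μ) ν)) -
      τ μ y ((τ ν (y - unitVec ν + unitVec μ)).symm (Y (y - unitVec ν + unitVec μ) ν))) with hE
  -- the identity `(ΣD*D)(Y·μ) = ΣD*G + E`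
  have hId : ∀ y : Zd d, ∑ ν, ((Y y μ + Y y μ) - (τ ν (y - unitVec ν)).symm (Y (y - unitVec ν) μ) - τ ν y (Y (y + unitVec ν) μ)) =
      (∑ ν, ((τ ν (y - unitVec ν)).symm (G (y - unitVec ν) ν) - G y ν)) + E y := by
    intro y
    have h := covLop_oneForm_eq τ Y C Dv (fun x ν μ' => rfl) (fun x => rfl) y μ
    rw [h]
  -- sizes: the data `G` on `Q_{R+1}`, the curvature term on `Q_{R+1}`
  have hGle : ∀ y ∈ box x₀ (R + 1), ∀ ν, ‖G y ν‖ ≤ κ + δ := by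
    intro y hy ν
    have hdv : ‖Dv (y + unitVec μ)‖ ≤ δ := by
      have := hdiv y hy
      simpa only [hDv] using this
    exact norm_oneFormData_le τ C Dv y ν μ (hcurl y hy ν) hδ0 hdv
  have hEle : ∀ y ∈ box x₀ (R + 1), ‖E y‖ ≤ θ * (((d : ℝ) - 1) * S) := fun y hy =>
    norm_curvTerm_le_of_sup τ Y y μ hθ0 (hHol y hy) (hS y hy)
  -- the curvature term as divergence-form data on `Q_{R+1}`
  obtain ⟨g₀, hg₀eq, hg₀le⟩ := exists_cov_antideriv hd0 τ E x₀ (R + 1) hEle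
  -- the sourced equation with data `G + g₀` on `Q_R(x₀)` (mass `0`)
  have hEq : ∀ y ∈ box x₀ R, (∑ ν, ((Y y μ + Y y μ) - (τ ν (y - unitVec ν)).symm (Y (y - unitVec ν) μ) - τ ν y (Y (y + unitVec ν) μ))) +
      (0 : ℝ) • Y y μ = ∑ ν, ((τ ν (y - unitVec ν)).symm ((G (y - unitVec ν) ν + g₀ (y - unitVec ν) ν)) - (G y ν + g₀ y ν)) := by
    intro y hy
    rw [zero_smul, add_zero, hId y, covDvg_add τ G g₀ y, hg₀eq y (box_mono x₀ (by linarith) hy)]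
  have hm0 : 0 ≤ κ + δ + (2 * ((R : ℝ) + 1) + 1) * (θ * (((d : ℝ) - 1) * S)) := by
    have hR0 : (0 : ℝ) ≤ R := by exact_mod_cast (show (0 : ℤ) ≤ R by linarith)
    have hd1 : (1 : ℝ) ≤ d := by exact_mod_cast hd
    have : 0 ≤ ((d : ℝ) - 1) * S := mul_nonneg (by linarith) hS0
    positivity
  have hgle : ∀ y ∈ box x₀ (R + 1), ∀ ν, ‖G y ν + g₀ y ν‖ ≤ κ + δ + (2 * ((R : ℝ) + 1) + 1) * (θ * (((d : ℝ) - 1) * S)) := by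
    intro y hy ν
    refine (norm_add_le _ _).trans (add_le_add (hGle y hy ν) ?_)
    have := hg₀le y hy ν
    push_cast at this
    exact this
  exact normSq_le_of_covSourced hd τ le_rfl (fun y => Y y μ) (fun y ν => G y ν + g₀ y ν) x₀ hR hm0 hEq hgle

end Summit.QuantumFields.YangMills.Theorems.PoincareLipschitzCovariantOneFormMeanValue

end
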